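import Summits.Ventures.YMGap.Thresholds.StateLipschitzRows
import Summits.Ventures.YMGap.RobustBall.StateStability
import Summits.Ventures.YMGap.RobustBall.LoopObservable
import HarnessLib

/-!
# Venture YMGap — WILSON LOOPS ARE LIPSCHITZ IN THE COUPLING AND IN THE ACTION, WITH A PERIMETER CONSTANT:
# inside the one-link window every Wilson-loop expectation `⟨Re tr U_γ / N⟩` moves by at most
# `(2(d−1)K/(1−c)) · |γ| · |β − β'|` in the 't Hooft coupling and by at most `(ε₀/(2(1−c))) · |γ|` across the ball,
# `|γ|` the length of the loop — `N`-free constants, linear in the perimeter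

HONEST FRAMING: venture file of the cell `pub-ymgap` (QuantumFields programme), seat ds-1; bookkeeping over the C-LIP row type
(`StateLipschitz`, `RobustBall.StateStability`) and rb-p1's loop observable `RobustBall.loopTerm` (`c · Re tr(U_γ)/N` for a closed
walk `γ` of `ℤ^d`, with its Frobenius-Lipschitz witness `|c| mult_γ(y)/√N`).  Strong-coupling LATTICE statements inside the
ONE-LINK Dobrushin window; Lipschitz (not `C¹`); no area-law / string-tension / continuum / Clay claim.

* `abs_loop_sub_loop_le` — coupling direction, every `SU(N)`, every `d ≥ 2`, every closed walk `γ`, every modulus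
  `OneLinkKRModulus N R K`: for DLR states `μ` at `β` (window, `c = 6(d−1)|β|K < 1`) and `ν` at `β'` (radius only):
  `|⟨Re tr U_γ/N⟩_μ − ⟨Re tr U_γ/N⟩_ν| ≤ K · 2(d−1) · |β − β'| / (1 − c) · |γ|`.
* `abs_loop_sub_loop_perturbed_le` — action direction: every DLR state `ν` of any bounded adapted finite-range member with
  one-link oscillation load `ε₀` vs the Wilson state `μ`: `≤ ε₀ / (2(1 − c)) · |γ|`.
* `su2_abs_loop_sub_loop_le` — `SU(2)`, `d = 4`, HYPOTHESIS-FREE (quarter modulus): for `0 ≤ β_W < 2/9`, any `0 ≤ β'_W ≤ 2/3`: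
  `|⟨½ Re tr U_γ⟩_{β_W} − ⟨½ Re tr U_γ⟩_{β'_W}| ≤ 3 |γ| |β_W − β'_W| / (2 − 9β_W)`.
* `su2_abs_loop_sub_loop_perturbed_le` — `SU(2)`, `d = 4`, HYPOTHESIS-FREE: for `0 ≤ β_W < 2/9` and every member of
  `MemBallZd ε₀ ε₁ R'`: `|⟨½ Re tr U_γ⟩_ν − ⟨½ Re tr U_γ⟩_μ| ≤ ε₀ |γ| / (2 − 9β_W)`.

References (mechanism): H. Föllmer, LNM 1362 (1988), Ch. I (2.8); E. Seiler, LNP 159 (1982), Ch. 1 (Wilson loops).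
-/

noncomputable section

open MeasureTheory Function Finset ProbabilityTheory Real SimpleGraph
open scoped NNReal
open Literature.Probability.LatticeModels
open Literature.Probability.LatticeModels.DobrushinMetric
open Literature.MathematicalPhysics.QuantumLattice
open Literature.MathematicalPhysics.QuantumFieldTheory hiding ZdEdge Site
open Literature.MathematicalPhysics.QuantumFieldTheory.Balaban1983to89.StrongCouplingDobrushinWindow
open Summit.Ventures.YMGap.SlabAreaLawDimensions (su2_oneLinkKRModulus_one_one)
open Summit.Ventures.YMGap.StateLipschitz
open Summit.Ventures.YMGap.RobustBall
open Summit.Ventures.YMGap.RobustBall.StateStability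

namespace Summit.Ventures.YMGap.WilsonLoopLipschitz

variable {d N : ℕ}

/-- The Lipschitz vector of the loop term sums to `|c| |γ| / √N` over the links of the walk. [folklore] -/
theorem sum_walkEdges_loopLip (c : ℝ) {x : Site d} (w : (zdGraph d).Walk x x) :
    ∑ y ∈ walkEdges w, |c| * (dartMult w y / Real.sqrt N) = |c| * w.length / Real.sqrt N := by
  rw [← Finset.mul_sum, ← Finset.sum_div, ← Nat.cast_sum, sum_walkEdges_dartMult]
  ring

/-- The loop term `c · Re tr U_γ / N` is measurable (it is continuous on the product space). [folklore] -/
theorem measurable_loopTerm (c : ℝ) {x : Site d} (w : (zdGraph d).Walk x x) :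
    Measurable (loopTerm (d := d) N c w) := by
  haveI : SecondCountableTopology (Matrix (Fin N) (Fin N) ℂ) :=
    inferInstanceAs (SecondCountableTopology (Fin N → Fin N → ℂ))
  haveI : SecondCountableTopology (Matrix.specialUnitaryGroup (Fin N) ℂ) :=
    Topology.IsEmbedding.subtypeVal.secondCountableTopology
  exact (continuous_loopTerm w).measurable

/-! ## §1 Coupling direction -/

/-- **Wilson loops are Lipschitz in the coupling, with a perimeter constant.**  `SU(N)` on `ℤ^d` (`d ≥ 2`, `N ≥ 2`),
`OneLinkKRModulus N R K`, `2(d−1)|β|, 2(d−1)|β'| ≤ R`, `c = 6(d−1)|β|K < 1`; `γ` a closed walk of length `|γ|`; `μ`, `ν` DLR states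
at `β`, `β'`: `|∫ Re tr U_γ/N dμ − ∫ Re tr U_γ/N dν| ≤ K · 2(d−1) · |β − β'| / (1 − c) · |γ|` (the `√N` of the staple bound cancels
the `1/√N` of the loop's Lipschitz witness). [cite: Follmer1988, Ch. I Comparison Theorem (2.8)] -/
theorem abs_loop_sub_loop_le (hd : 2 ≤ d) (hN : 2 ≤ N) {β β' R K : ℝ} (hK : 0 ≤ K)
    (hR : |β| * (2 * ((d : ℝ) - 1)) ≤ R) (hR' : |β'| * (2 * ((d : ℝ) - 1)) ≤ R)
    (hmod : OneLinkKRModulus N R K) (hsmall : 6 * ((d : ℝ) - 1) * |β| * K < 1)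
    {μ ν : Measure (LGConfig d (Matrix.specialUnitaryGroup (Fin N) ℂ))}
    (hμ : μ ∈ ymGibbsMeasures (d := d) (fundamentalRep (Fin N)) (N * β))
    (hν : ν ∈ ymGibbsMeasures (d := d) (fundamentalRep (Fin N)) (N * β'))
    {x : Site d} (w : (zdGraph d).Walk x x) :
    |(∫ σ, loopTerm N 1 w σ ∂μ) - ∫ σ, loopTerm N 1 w σ ∂ν| ≤
      K * (2 * ((d : ℝ) - 1)) * |β - β'| / (1 - 6 * ((d : ℝ) - 1) * |β| * K) * w.length := by
  have hN0 : (0 : ℝ) < N := by exact_mod_cast (show 0 < N by omega)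
  have hsq : 0 < Real.sqrt N := Real.sqrt_pos.2 hN0
  have key := abs_integral_sub_integral_le_of_oneLinkKRModulus hd hN hK hR hR' hmod hsmall hμ hν
    (measurable_loopTerm 1 w) (dependsOn_loopTerm w) (abs_loopTerm_le w) (isLipBound_loopTerm w)
  rw [sum_walkEdges_loopLip, abs_one, one_mul] at key
  refine key.trans (le_of_eq ?_)
  field_simp

/-! ## §2 Action direction (across the ball) -/

/-- **Wilson loops move by at most `ε₀ |γ| / (2(1−c))` across the ball.**  For every DLR state `ν` of a bounded adapted
finite-range member `N β S_W + W` with one-link oscillation load `≤ ε₀`, and the Wilson DLR state `μ` at `β` inside the one-link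
window: `|∫ Re tr U_γ/N dμ − ∫ Re tr U_γ/N dν| ≤ ε₀ / (2 (1 − c)) · |γ|`. [cite: Follmer1988, Ch. I Comparison Theorem (2.8)] -/
theorem abs_loop_sub_loop_perturbed_le (hd : 2 ≤ d) (hN : 2 ≤ N) {β R K : ℝ} (hK : 0 ≤ K)
    (hR : |β| * (2 * ((d : ℝ) - 1)) ≤ R) (hmod : OneLinkKRModulus N R K)
    (hsmall : 6 * ((d : ℝ) - 1) * |β| * K < 1)
    {W : Potential (ZdEdge d) (Matrix.specialUnitaryGroup (Fin N) ℂ)} (hW : W.IsAdapted)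
    (hWb : ∀ X, ∃ C, ∀ U, |W X U| ≤ C) {supp : Finset (ZdEdge d) → Finset (Finset (ZdEdge d))}
    (hsupp : W.IsSupportedBy supp) {osc : Finset (ZdEdge d) → ZdEdge d → ℝ}
    (hosc : ∀ X, Dobrushin.IsOscBound (W X) (osc X)) {ε₀ : ℝ}
    (hosca : ∀ e, ∑ X ∈ (supp {e}).filter (fun X => e ∈ X), osc X e ≤ ε₀)
    {μ ν : Measure (LGConfig d (Matrix.specialUnitaryGroup (Fin N) ℂ))}
    (hμ : μ ∈ ymGibbsMeasures (d := d) (fundamentalRep (Fin N)) (N * β))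
    (hν : ν ∈ perturbedGibbsMeasures (d := d) (fundamentalRep (Fin N)) (N * β) W supp)
    {x : Site d} (w : (zdGraph d).Walk x x) :
    |(∫ σ, loopTerm N 1 w σ ∂μ) - ∫ σ, loopTerm N 1 w σ ∂ν| ≤
      ε₀ / (2 * (1 - 6 * ((d : ℝ) - 1) * |β| * K)) * w.length := by
  have hN0 : (0 : ℝ) < N := by exact_mod_cast (show 0 < N by omega)
  have hsq : 0 < Real.sqrt N := Real.sqrt_pos.2 hN0
  have h1c : 0 < 1 - 6 * ((d : ℝ) - 1) * |β| * K := sub_pos.2 hsmall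
  have key := abs_integral_sub_integral_perturbed_le hd hN hK hR hmod hsmall hW hWb hsupp hosc hosca hμ hν
    (measurable_loopTerm 1 w) (dependsOn_loopTerm w) (abs_loopTerm_le w) (isLipBound_loopTerm w)
  rw [sum_walkEdges_loopLip, abs_one, one_mul] at key
  refine key.trans (le_of_eq ?_)
  field_simp

/-! ## §3 `SU(2)`, `d = 4`, Wilson units, hypothesis-free -/

/-- **`SU(2)`, `d = 4`: Wilson loops are `3|γ|/(2 − 9β_W)`-Lipschitz in the Wilson coupling**, hypothesis-free (quarter
modulus): for `0 ≤ β_W < 2/9`, any `0 ≤ β'_W ≤ 2/3`, DLR states `μ`, `ν` at bare couplings `β_W/2`, `β'_W/2`, and every closed walk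
`γ`: `|∫ ½Re tr U_γ dμ − ∫ ½Re tr U_γ dν| ≤ 3 |γ| |β_W − β'_W| / (2 − 9 β_W)`. [cite: Follmer1988, Ch. I Comparison Theorem (2.8)] -/
theorem su2_abs_loop_sub_loop_le {βW βW' : ℝ} (h0 : 0 ≤ βW) (h29 : βW < 2 / 9) (h0' : 0 ≤ βW') (h23 : βW' ≤ 2 / 3)
    {μ ν : Measure (LGConfig 4 (Matrix.specialUnitaryGroup (Fin 2) ℂ))}
    (hμ : μ ∈ ymGibbsMeasures (d := 4) (fundamentalRep (Fin 2)) (2 * (βW / 4)))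
    (hν : ν ∈ ymGibbsMeasures (d := 4) (fundamentalRep (Fin 2)) (2 * (βW' / 4)))
    {x : Site 4} (w : (zdGraph 4).Walk x x) :
    |(∫ σ, loopTerm 2 1 w σ ∂μ) - ∫ σ, loopTerm 2 1 w σ ∂ν| ≤ 3 * w.length * |βW - βW'| / (2 - 9 * βW) := by
  have hR : |βW / 4| * (2 * (((4 : ℕ) : ℝ) - 1)) ≤ 1 := by
    rw [abs_of_nonneg (by positivity)]; push_cast; linarith
  have hR' : |βW' / 4| * (2 * (((4 : ℕ) : ℝ) - 1)) ≤ 1 := by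
    rw [abs_of_nonneg (by positivity)]; push_cast; linarith
  have hs : 6 * (((4 : ℕ) : ℝ) - 1) * |βW / 4| * 1 < 1 := by
    rw [abs_of_nonneg (by positivity)]; push_cast; linarith
  have key := abs_loop_sub_loop_le (d := 4) (N := 2) (by norm_num) le_rfl zero_le_one hR hR'
    su2_oneLinkKRModulus_one_one hs hμ hν w
  have he : (1 : ℝ) * (2 * (((4 : ℕ) : ℝ) - 1)) * |βW / 4 - βW' / 4| / (1 - 6 * (((4 : ℕ) : ℝ) - 1) * |βW / 4| * 1) *
      (w.length : ℝ) = 3 * w.length * |βW - βW'| / (2 - 9 * βW) := by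
    have h9 : (2 : ℝ) - 9 * βW ≠ 0 := by linarith
    rw [abs_of_nonneg (by positivity : (0 : ℝ) ≤ βW / 4), show βW / 4 - βW' / 4 = (βW - βW') / 4 by ring, abs_div,
      abs_of_pos (by norm_num : (0 : ℝ) < 4)]
    push_cast
    rw [div_mul_eq_mul_div, div_eq_div_iff (by linarith) h9]
    ring
  rw [he] at key
  exact key

/-- **`SU(2)`, `d = 4`: Wilson loops move by at most `ε₀ |γ| / (2 − 9β_W)` across the ball**, hypothesis-free: for
`0 ≤ β_W < 2/9`, every member `(W, supp)` of `MemBallZd ε₀ ε₁ R'`, every DLR state `ν` of the member and the Wilson DLR state `μ`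
at bare coupling `β_W/2`, every closed walk `γ`. [cite: Follmer1988, Ch. I Comparison Theorem (2.8)] -/
theorem su2_abs_loop_sub_loop_perturbed_le {βW ε₀ ε₁ R' : ℝ} (h0 : 0 ≤ βW) (h29 : βW < 2 / 9)
    {W : Potential (ZdEdge 4) (Matrix.specialUnitaryGroup (Fin 2) ℂ)}
    {supp : Finset (ZdEdge 4) → Finset (Finset (ZdEdge 4))} (hmem : MemBallZd ε₀ ε₁ R' W supp)
    {μ ν : Measure (LGConfig 4 (Matrix.specialUnitaryGroup (Fin 2) ℂ))}
    (hμ : μ ∈ ymGibbsMeasures (d := 4) (fundamentalRep (Fin 2)) (2 * (βW / 4)))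
    (hν : ν ∈ perturbedGibbsMeasures (d := 4) (fundamentalRep (Fin 2)) (2 * (βW / 4)) W supp)
    {x : Site 4} (w : (zdGraph 4).Walk x x) :
    |(∫ σ, loopTerm 2 1 w σ ∂μ) - ∫ σ, loopTerm 2 1 w σ ∂ν| ≤ ε₀ * w.length / (2 - 9 * βW) := by
  haveI : SecondCountableTopology (Matrix (Fin 2) (Fin 2) ℂ) :=
    inferInstanceAs (SecondCountableTopology (Fin 2 → Fin 2 → ℂ))
  haveI : SecondCountableTopology (Matrix.specialUnitaryGroup (Fin 2) ℂ) :=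
    Topology.IsEmbedding.subtypeVal.secondCountableTopology
  have hR : |βW / 4| * (2 * (((4 : ℕ) : ℝ) - 1)) ≤ 1 := by
    rw [abs_of_nonneg (by positivity)]; push_cast; linarith
  have hs : 6 * (((4 : ℕ) : ℝ) - 1) * |βW / 4| * 1 < 1 := by
    rw [abs_of_nonneg (by positivity)]; push_cast; linarith
  obtain ⟨osc, lip, hosc, -, hosca, -⟩ := hmem.loads
  have hW : W.IsAdapted := fun X => ⟨hmem.dependsOn X, (hmem.continuous X).measurable⟩
  have hWb : ∀ X, ∃ C, ∀ U, |W X U| ≤ C := fun X => exists_bound_of_continuous (hmem.continuous X)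
  have key := abs_loop_sub_loop_perturbed_le (d := 4) (N := 2) (by norm_num) le_rfl zero_le_one hR
    su2_oneLinkKRModulus_one_one hs hW hWb hmem.supportedBy hosc hosca hμ hν w
  have he : ε₀ / (2 * (1 - 6 * (((4 : ℕ) : ℝ) - 1) * |βW / 4| * 1)) * (w.length : ℝ) =
      ε₀ * w.length / (2 - 9 * βW) := by
    have h9 : (2 : ℝ) - 9 * βW ≠ 0 := by linarith
    rw [abs_of_nonneg (by positivity : (0 : ℝ) ≤ βW / 4)]
    push_cast
    rw [div_mul_eq_mul_div, div_eq_div_iff (by linarith) h9]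
    ring
  rw [he] at key
  exact key

end Summit.Ventures.YMGap.WilsonLoopLipschitz

end
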